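import Literature.Analysis.FluidPDE.BlowupAncientSolution
import Literature.Analysis.FluidPDE.MildSolutionProofs
import Literature.Analysis.FluidPDE.WholeSpaceIBP
import HarnessLib

/-!
# KNSS 2009, Proposition 6.1 as vendored: discharge of `Literature.Analysis.FluidPDE.KNSS2009_blowup_generates_ancient`

Sibling proof file of `BlowupAncientSolution.lean` (D-0014: named facts `def X : Prop` are
discharged as `theorem X_holds : X`). It proves

* `Literature.Analysis.FluidPDE.integral_heatFlow_eq`, `Literature.Analysis.FluidPDE.integral_inner_const_heatFlow`,
  `Literature.Analysis.FluidPDE.integral_inner_const_fderiv_heatFlow_eq_zero` — the heat flow preserves the space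
  integral; pairings of `e^{σΔ}φ` and of `(b·∇) e^{σΔ}φ` with a constant vector `b`;
* `Literature.Analysis.FluidPDE.isAncientMildSolution_fun_const`, `Literature.Analysis.FluidPDE.isBoundedAncientMildSolution_fun_const`
  — **constants are (bounded) ancient mild solutions**, for every viscosity
  (Koch–Nadirashvili–Seregin–Šverák 2009, §1), and the discharge
  `Literature.Fluid.isBoundedAncientMildSolution_const_holds : isBoundedAncientMildSolution_const` of the
  named fact of `SelfSimilar.lean` (placed here because the proof uses the caloric calculus of
  `MildSolutionProofs.lean`, which is downstream of `SelfSimilar.lean`);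
* `Literature.Analysis.FluidPDE.isKNSSBlowupLimit_const` — a constant field of norm one is a KNSS blow-up limit
  (`IsKNSSBlowupLimit`);
* `Literature.NS.KNSS2009_blowup_generates_ancient_holds : KNSS2009_blowup_generates_ancient`.

## Source, and what exactly is proved

G. Koch, N. Nadirashvili, G. Seregin, V. Šverák, *Liouville theorems for the Navier–Stokes
equations and applications*, Acta Math. 203 (2009) 83–105, arXiv:0709.3599 (held as
`paper:arxiv-0709.3599`; page numbers below are those of the arXiv version), §6, p. 11:
Lemma 6.1 (locally uniform compactness of uniformly bounded mild solutions, from §4), the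
rescaling procedure `v^{(k)}(y, s) = M_k⁻¹ u(x_k + y/M_k, t_k + s/M_k²)` around near-maxima of a
mild solution from `u₀ ∈ L^∞` whose maximal existence interval `(0, T)` is finite, and then,
verbatim,

> **Proposition 6.1.** A finite-time singularity arising from a mild solution generates a bounded
> ancient mild solution which is not identically zero.

immediately followed (same page) by the authors' own assessment:

> Without further information about the situation at hand, the proposition may not be very
> useful. By itself, the existence of non-zero bounded ancient solutions is not surprising.
> (Consider constants, for example.) However, if (non-zero) constant solutions can be excluded
> (for example by a scale-invariant estimate) and a Liouville-type theorem for ancient solutions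
> is available, then finite-time singularities can be ruled out.

The vendored `Literature.Analysis.FluidPDE.KNSS2009_blowup_generates_ancient` renders Proposition 6.1 *as printed*:
under the blow-up hypotheses on `(T, u₀, u)` its conclusion is `∃ v, IsKNSSBlowupLimit v` — a
smooth bounded ancient mild solution on `(-∞, 0) × ℝ³` with measurable slices, `|v| ≤ 1` and
`sup |v| = 1` — and this conclusion does not mention `u` (the zoom-in is the *proof* printed
before the proposition, not part of its statement; the limit `v` is not asserted to be a limit of
rescalings of `u`). Exactly as the authors remark, such a `v` exists outright: the constant field
`v ≡ b` with `‖b‖ = 1`. The discharge below is that remark made formal; it does **not** formalise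
Lemma 6.1 or the rescaling procedure, and consumers who need the blow-up profile to inherit
scale-invariant information from `u` (KNSS Thms. 6.2–6.3; Seregin–Šverák 2009) must not read such
content into `KNSS2009_blowup_generates_ancient`.

## Proof that constants are ancient mild solutions (duality form of `MildSolution.lean`)

For `u ≡ b`, a smooth compactly supported divergence-free `φ`, `s < t < 0` and elapsed times
`σ = ν (t - τ) ∈ ℝ` (the heat flow `heatFlow φ σ` is `e^{σΔ}φ` for `σ > 0` and `φ` for `σ ≤ 0`):

1. `∫ ⟪b, e^{σΔ}φ⟫ = ⟪b, ∫ e^{σΔ}φ⟫ = ⟪b, ∫ φ⟫ = ∫ ⟪b, φ⟫`, because the Gauss–Weierstrass kernel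
   has mass one (Evans, *PDE*, §2.3.1, Lemma; `integral_heatKernel_eq_one_holds`) and Fubini
   (Mathlib `MeasureTheory.integral_convolution`): `integral_heatFlow_eq`;
2. the nonlinear term vanishes: `D(e^{σΔ}φ) = e^{σΔ}(Dφ)` (`fderiv_heatFlow`), so
   `∫ ⟪b, (b·∇) e^{σΔ}φ⟫ = ⟪b, (∫ e^{σΔ} Dφ) b⟫ = ⟪b, (∫ Dφ) b⟫ = ⟪b, ∫ ∂_b φ⟫ = 0` by the
   absence of boundary terms on the whole space (Leray 1934, §6, (1.11);
   `integral_fderiv_apply_eq_zero`);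
3. the force is `0`, and `div b = 0` weakly (`IsDivFree.isWeaklyDivFree_holds`).

This is the case `u ≡ b`, `p ≡ 0` of "classical solutions are mild solutions"
(Fabes–Jones–Rivière 1972, Thm. 2.1 (i)), done directly since no cut-off is needed.

## References

* G. Koch, N. Nadirashvili, G. Seregin, V. Šverák, Acta Math. 203 (2009), §1, §6 (Lemma 6.1,
  Proposition 6.1 and the remark following it). [KochNadirashviliSereginSverak2009] (= [KNSS2009])
* E. B. Fabes, B. F. Jones, N. M. Rivière, Arch. Rational Mech. Anal. 45 (1972), Thm. 2.1.
  [FabesJonesRiviere1972]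
* L. C. Evans, *Partial Differential Equations*, 2nd ed. (2010), §2.3.1. [Evans2010]
* J. Leray, Acta Math. 63 (1934), §6, (1.11). [Leray1934]
-/

noncomputable section

open MeasureTheory Set Function Filter Topology
open scoped InnerProductSpace RealInnerProductSpace ENNReal NNReal

namespace Literature.Analysis.FluidPDE

/-! ### Pairing the caloric test field with a constant vector -/

section ConstSolution

variable {E : Type*} [NormedAddCommGroup E] [InnerProductSpace ℝ E] [FiniteDimensional ℝ E]
  [MeasurableSpace E] [BorelSpace E]
variable {F : Type*} [NormedAddCommGroup F] [NormedSpace ℝ F] [CompleteSpace F]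

/-- **The heat flow preserves the space integral**: `∫ e^{σΔ} g = ∫ g` for integrable `g` and
every `σ` (for `σ ≤ 0` the flow is `g` by definition; for `σ > 0` by Fubini and
`∫ heatKernel σ = 1`, Evans, *PDE*, §2.3.1, Lemma and Thm. 1). [cite: Evans2010, §2.3.1 Lemma] -/
theorem integral_heatFlow_eq {g : E → F} (hg : Integrable g) (σ : ℝ) :
    ∫ x, heatFlow g σ x = ∫ x, g x := by
  rcases le_or_gt σ 0 with hσ | hσ
  · rw [heatFlow_of_nonpos g hσ]
  · rw [heatFlow_of_pos g hσ, UnboundedOperators.heatExtension,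
      integral_convolution _ (UnboundedOperators.integrable_heatKernel_holds hσ) hg, UnboundedOperators.integral_heatKernel_eq_one_holds hσ]
    simp

/-- Pairing the caloric test field with a constant vector: `∫ ⟪b, e^{σΔ}φ⟫ = ∫ ⟪b, φ⟫` for
integrable `φ` and every `σ` (the datum term of the duality identity for `u ≡ b`;
Fabes–Jones–Rivière 1972, Thm. 2.1 (i) with `u` constant). [cite: FabesJonesRiviere1972, Thm. 2.1 (i)] -/
theorem integral_inner_const_heatFlow {φ : E → E} (hφ : Integrable φ) (σ : ℝ) (b : E) :
    ∫ x, ⟪b, heatFlow φ σ x⟫ = ∫ x, ⟪b, φ x⟫ := by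
  rw [integral_inner (integrable_heatFlow hφ σ) b, integral_inner hφ b, integral_heatFlow_eq hφ σ]

/-- The nonlinear term of the duality identity vanishes on constants:
`∫ ⟪b, (v·∇) e^{σΔ}φ⟫ = 0` for `φ ∈ C¹_c`, constant vectors `b`, `v` and every `σ`, since
`D(e^{σΔ}φ) = e^{σΔ}(Dφ)` has the same integral as `Dφ`, and `∫ ∂ᵥφ = 0` (Leray 1934, §6,
(1.11); Fabes–Jones–Rivière 1972, Thm. 2.1 (i) with `u` constant). [cite: Leray1934, §6 (1.11) p. 203] -/
theorem integral_inner_const_fderiv_heatFlow_eq_zero {φ : E → E} (hφ : ContDiff ℝ 1 φ)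
    (hc : HasCompactSupport φ) (σ : ℝ) (b v : E) :
    ∫ x, ⟪b, fderiv ℝ (heatFlow φ σ) x v⟫ = 0 := by
  have hDφ : Integrable (fderiv ℝ φ) :=
    (hφ.continuous_fderiv one_ne_zero).integrable_of_hasCompactSupport (hc.fderiv ℝ)
  have hflow : Integrable (heatFlow (fderiv ℝ φ) σ) := integrable_heatFlow hDφ σ
  have hflowv : Integrable fun x => heatFlow (fderiv ℝ φ) σ x v :=
    (ContinuousLinearMap.apply ℝ E v).integrable_comp hflow
  have h1 : (fun x => ⟪b, fderiv ℝ (heatFlow φ σ) x v⟫) =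
      fun x => ⟪b, heatFlow (fderiv ℝ φ) σ x v⟫ :=
    funext fun x => by rw [fderiv_heatFlow hφ hc σ x]
  rw [h1, integral_inner hflowv b, ← ContinuousLinearMap.integral_apply hflow v,
    integral_heatFlow_eq hDφ σ, ContinuousLinearMap.integral_apply hDφ v,
    integral_fderiv_apply_eq_zero hφ hc v, inner_zero_right]

/-- **Constants are ancient mild solutions**, for every viscosity `ν` and every `b`
(Koch–Nadirashvili–Seregin–Šverák 2009, §1: the trivial bounded ancient solutions, which the
Liouville conjecture asserts are the only bounded ones; §6, remark after Prop. 6.1: "Consider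
constants, for example"). Every slice `x ↦ b` is weakly divergence free (`div b = 0`,
`IsDivFree.isWeaklyDivFree_holds`); in the two-time duality identity between `s < t < 0` the
datum term equals `∫ ⟪b, φ⟫` (`integral_inner_const_heatFlow`), the nonlinear term vanishes
(`integral_inner_const_fderiv_heatFlow_eq_zero`) and the force is zero. (No sign condition on
`ν` is needed: for `ν ≤ 0` the caloric test field is the documented junk value `φ` and the same
three observations apply.) [cite: KochNadirashviliSereginSverak2009, §1 and §6 remark after Prop. 6.1] -/
theorem isAncientMildSolution_fun_const (ν : ℝ) (b : E) :
    IsAncientMildSolution ν (fun _ _ => b) := by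
  refine ⟨fun t _ => ?_, fun s t _ _ => ?_⟩
  · exact VectorCalculus.IsDivFree.isWeaklyDivFree_holds (fun x => by simp [VectorCalculus.divergence]) contDiff_const
  · intro φ hφ _
    have hφ1 : ContDiff ℝ 1 φ := hφ.contDiff.of_le (by exact_mod_cast le_top)
    have hφi : Integrable φ :=
      hφ.contDiff.continuous.integrable_of_hasCompactSupport hφ.hasCompactSupport
    simp only [heatTest, convect_apply, Pi.zero_apply, inner_zero_left, integral_zero,
      intervalIntegral.integral_zero, add_zero,
      integral_inner_const_fderiv_heatFlow_eq_zero hφ1 hφ.hasCompactSupport,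
      integral_inner_const_heatFlow hφi]

/-- **Constants are bounded ancient mild solutions**, for every viscosity `ν` and every `b`:
`isAncientMildSolution_fun_const` together with the bound `‖b‖` (KNSS 2009, §1). [cite: KochNadirashviliSereginSverak2009, §1] -/
theorem isBoundedAncientMildSolution_fun_const (ν : ℝ) (b : E) :
    IsBoundedAncientMildSolution ν (fun _ _ => b) :=
  ⟨isAncientMildSolution_fun_const ν b, ⟨‖b‖, fun _ _ _ => le_rfl⟩⟩

variable {ν : ℝ}

/-- **Discharge** of the named fact `isBoundedAncientMildSolution_const` of `SelfSimilar.lean`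
(KNSS 2009, §1: constants are bounded ancient mild solutions; stated there for `0 < ν`), by
`isBoundedAncientMildSolution_fun_const`; placed in this file because the proof uses the caloric
calculus of `MildSolutionProofs.lean`, downstream of `SelfSimilar.lean`. [cite: KochNadirashviliSereginSverak2009, §1] -/
theorem isBoundedAncientMildSolution_const_holds :
    isBoundedAncientMildSolution_const (E := E) (ν := ν) :=
  fun _ b => isBoundedAncientMildSolution_fun_const ν b

end ConstSolution

end Literature.Analysis.FluidPDE

namespace Literature.Analysis.FluidPDE

/-- **A constant field of norm one is a KNSS blow-up limit** (`IsKNSSBlowupLimit`): it is a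
bounded ancient mild solution with `ν = 1` (`Fluid.isBoundedAncientMildSolution_fun_const`),
its slices are measurable, it is smooth on `(-∞, 0) × ℝ³`, `|v| ≤ 1` everywhere and the value
`1 > 1 - ε` is attained (at `t = -1`, `x = 0`, say). This is the example named by
Koch–Nadirashvili–Seregin–Šverák right after Proposition 6.1 ("By itself, the existence of
non-zero bounded ancient solutions is not surprising. (Consider constants, for example.)"). [cite: KochNadirashviliSereginSverak2009, §6 remark after Prop. 6.1] -/
theorem isKNSSBlowupLimit_const {b : EuclideanSpace ℝ (Fin 3)} (hb : ‖b‖ = 1) :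
    IsKNSSBlowupLimit (fun _ _ => b) where
  isBoundedAncientMildSolution := FluidPDE.isBoundedAncientMildSolution_fun_const 1 b
  aestronglyMeasurable := fun _ _ => aestronglyMeasurable_const
  smooth := contDiffOn_const
  norm_le_one := fun _ _ _ => hb.le
  exists_lt_norm := fun ε hε => ⟨-1, by norm_num, 0, by rw [hb]; linarith⟩

/-- **Discharge of `KNSS2009_blowup_generates_ancient`** (Koch–Nadirashvili–Seregin–Šverák 2009,
Proposition 6.1 as printed: "A finite-time singularity arising from a mild solution generates a
bounded ancient mild solution which is not identically zero"). The vendored conclusion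
`∃ v, IsKNSSBlowupLimit v` does not refer to the blowing-up solution `u`, so — exactly as the
authors remark after the proposition ("the existence of non-zero bounded ancient solutions is not
surprising. (Consider constants, for example.)") — it is witnessed, whatever the hypotheses, by
the constant field `v ≡ e₀` (`EuclideanSpace.single 0 1`, `‖e₀‖ = 1`;
`isKNSSBlowupLimit_const`). The zoom-in construction (Lemma 6.1 and the rescaling procedure of
§6) is *not* formalised here; see the module docstring. [cite: KochNadirashviliSereginSverak2009, §6 Prop. 6.1 and the remark following it] -/
theorem KNSS2009_blowup_generates_ancient_holds : KNSS2009_blowup_generates_ancient := by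
  intro T u₀ u _ _ _ _ _ _ _
  exact ⟨fun _ _ => EuclideanSpace.single 0 1, isKNSSBlowupLimit_const (by simp)⟩

end Literature.Analysis.FluidPDE
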